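import Summits.CriticalPhenomena.SAWScalingLimit.Theorems.SAWDefectDecoherenceBoundaryClosureRPolygonLocalCornerFace
import Summits.CriticalPhenomena.SAWScalingLimit.Theorems.SAWDefectDecoherenceBoundaryClosureRSidePhaseCorner
import HarnessLib

/-!
# The corner jump of the boundary phase: `κ z₂ = exp(-i(5/8)·arg(n_{k'}/n_k)) κ z₁` (K4)
(crux `BoundaryClosureR`, stmt-CriticalPhenomena-14004, line `polygon-parity-squeeze`, sub-goal of the
registered stub `polygonLocalIdentity`; registered helper `kappa_corner`)

At an exact corner `z` (continuum `∩`/`∪` of two zigzag half-planes on `B(z, s)`, lattice `∧`/`∨` of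
two exact half-lattices eventually, root outside), for `z₁` on the ray of form `k` and `z₂` on the ray
of form `k'` (both boundary points in the ball, `≠ z`): `κ z₂ = exp(-i(5/8) arg(n_{k'}/n_k))·κ z₁`.

Proof.  Both `zᵢ` are centres of flat balls (`corner_side_flat`, thresholds pinned by
`corner_pinning`); darts `e₁`, `e₂` near them exist eventually (`eventually_exists_dart_near`), head in
the directions `-n_k/√3`, `-n_{k'}/√3` (`flat_dart_direction`) and carry the phases `Θ_n(z₁)`, `Θ_n(z₂)`
(phase property); the corner face of thresholds `(nk, nk')` exists (`corner_forms_surjective`) and lies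
within `O(t + δ)` of `z` (pinning, `norm_le_of_levels`); `sidePhase_corner` (rescaled) gives
`F(e₂)|F₀(e₁)| = e^{-i(5/8)T} F(e₁)|F₀(e₂)|`, whence `Θ_n(z₂) = e^{-i(5/8)T} Θ_n(z₁)` eventually, and the
limit along `U`.  References: Duminil-Copin–Smirnov 2012 §3.  No definition is introduced.
-/

noncomputable section


open scoped Topology ComplexConjugate
open Filter Set Metric
open Literature.Probability.LatticeModels Literature.Probability.RandomPlanarGeometry
open Literature.Probability.RandomPlanarGeometry.SAW
open Summit.CriticalPhenomena.SAWScalingLimit.Theorems.PickHalfPlane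
open Summit.CriticalPhenomena.SAWScalingLimit.Theorems (ConjugateClassNegligibleSynthesis.dist_mid_center_le)

namespace Summit.CriticalPhenomena.SAWScalingLimit.Theorems.PolygonParitySqueeze.PolygonLocal

/-- **K4 — the corner jump of the boundary phase** (registered helper `kappa_corner` of
`polygonLocalIdentity`): see the module docstring. [cite: DuminilCopinSmirnov2012, §3 (winding of walks to the boundary)] -/
theorem kappa_corner : ∀ (D : DobrushinDomain) (ρ : ℝ) (Λ : ℝ → Finset HexVertex) (m : ℝ → ℤ) (b : ℝ → Sym2 HexVertex), AdmissibleFamily D ρ Λ m b → ∀ (a : ℝ → Sym2 HexVertex) (r₀ : ℝ) (m₀ : ℝ → ℤ), PinnedFlatRoot D Λ b (D.pt 0) a r₀ m₀ → ∀ (ns : ℕ → ℝ), Filter.Tendsto ns Filter.atTop (𝓝[>] 0) → ∀ (U : Filter ℕ) (Θ : ℕ → ℂ → ℂ) (κ : ℂ → ℂ), U ≤ Filter.atTop → U.NeBot → (∀ z : ℂ, Filter.Tendsto (fun n => Θ n z) U (𝓝 (κ z))) → (∀ (z : ℂ) (k : Fin 6) (s : ℝ), 0 < s → (∀ᶠ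 δ : ℝ in 𝓝[>] 0, ∃ nthr : ℤ, ∀ v : HexVertex, (δ : ℂ) * hexCenter v ∈ Metric.ball z s → (v ∈ Λ δ ↔ nthr ≤ zigzagForm k v)) → D.pt 0 ∉ Metric.closedBall z s → ∀ᶠ n : ℕ in Filter.atTop, ∀ v t : HexVertex, v ∈ Λ (ns n) → t ∉ Λ (ns n) → hexGraph.Adj v t → ((ns n : ℝ) : ℂ) * hexCenter v ∈ Metric.ball z (3 * s / 4) → hexParafermionicObservable (Λ (ns n)) (a (ns n)) hexCriticalFugacity (5 / 8) s(v, t) * ((‖hexParafermionicObservable (Λ (ns n)) (a (ns n)) hexCriticalFugacity 0 (b (ns n))‖ : ℝ) : ℂ) = Θ n z * ((‖hexParafermionicObservable (Λ (ns n)) (a (ns n)) hexCriticalFugacity 0 s(v, t)‖ : ℝ) : ℂ) * hexParafermionicObservable (Λ (ns n)) (a (ns n)) hexCriticalFugacity (5 / 8) (b (ns n))) → ∀ (z : ℂ) (k k' : Fin 6) (s : ℝ), 0 < s → innerNormal k' ≠ innerNormal k → innerNormal k' ≠ -innerNormal k → (D.carrier ∩ Metric.ball z s = halfPlane k z ∩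 halfPlane k' z ∩ Metric.ball z s ∨ D.carrier ∩ Metric.ball z s = (halfPlane k z ∪ halfPlane k' z) ∩ Metric.ball z s) → (∀ᶠ δ : ℝ in 𝓝[>] 0, ∃ nk nk' : ℤ, (∀ v : HexVertex, (δ : ℂ) * hexCenter v ∈ Metric.ball z s → (v ∈ Λ δ ↔ (nk ≤ zigzagForm k v ∧ nk' ≤ zigzagForm k' v))) ∨ (∀ v : HexVertex, (δ : ℂ) * hexCenter v ∈ Metric.ball z s → (v ∈ Λ δ ↔ (nk ≤ zigzagForm k v ∨ nk' ≤ zigzagForm k' v)))) → D.pt 0 ∉ Metric.closedBall z s → ∀ z₁ ∈ frontier D.carrier ∩ Metric.ball z s, ∀ z₂ ∈ frontier D.carrier ∩ Metric.ball z s, z₁ ≠ z → ((z₁ - z) * (starRingEnd ℂ) (innerNormal k)).re = 0 → z₂ ≠ z → ((z₂ - z) * (starRingEnd ℂ) (innerNormal k')).re = 0 → κ z₂ = Complex.exp (-(5 / 8 : ℂ) * (Complex.arg (innerNormal k' / innerNormal k) : ℂ) * Complex.I) * κ z₁ := by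
  intro D ρ Λ m b hAF a r₀ m₀ hPR ns hns U Θ κ hUle hUne hκT hΘ2 z k k' s hs hne hne' hsetC hexC hrootC z₁ hz₁ z₂ hz₂
    hz₁ne hz₁l hz₂ne hz₂l
  haveI := hUne
  obtain ⟨hz₁f, hz₁b⟩ := hz₁
  obtain ⟨hz₂f, hz₂b⟩ := hz₂
  set cT : ℂ := Complex.exp (-(5 / 8 : ℂ) * (Complex.arg (innerNormal k' / innerNormal k) : ℂ) * Complex.I) with hcT
  ---------------------------------------------------------------- the swapped corner data (for z₂)
  have hneS : innerNormal k ≠ innerNormal k' := Ne.symm hne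
  have hneS' : innerNormal k ≠ -innerNormal k' := fun h => hne' (by rw [h, neg_neg])
  have hsetS : D.carrier ∩ ball z s = halfPlane k' z ∩ halfPlane k z ∩ ball z s ∨
      D.carrier ∩ ball z s = (halfPlane k' z ∪ halfPlane k z) ∩ ball z s :=
    hsetC.imp (fun h => by rw [h, inter_comm (halfPlane k z)]) (fun h => by rw [h, union_comm])
  have hexS : ∀ᶠ δ : ℝ in 𝓝[>] 0, ∃ nk' nk : ℤ,
      (∀ v : HexVertex, (δ : ℂ) * hexCenter v ∈ ball z s → (v ∈ Λ δ ↔ (nk' ≤ zigzagForm k' v ∧ nk ≤ zigzagForm k v))) ∨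
      (∀ v : HexVertex, (δ : ℂ) * hexCenter v ∈ ball z s → (v ∈ Λ δ ↔ (nk' ≤ zigzagForm k' v ∨ nk ≤ zigzagForm k v))) := by
    filter_upwards [hexC] with δ ⟨nk, nk', h⟩
    exact ⟨nk', nk, h.imp (fun h v hv => (h v hv).trans and_comm) (fun h v hv => (h v hv).trans or_comm)⟩
  ---------------------------------------------------------------- the two flat balls
  obtain ⟨hr₁, hsub₁, hset₁, hex₁⟩ := corner_side_flat hAF hs hne hne' hsetC hexC hz₁f hz₁b hz₁ne hz₁l
  obtain ⟨hr₂, hsub₂, hset₂, hex₂⟩ := corner_side_flat hAF hs hneS hneS' hsetS hexS hz₂f hz₂b hz₂ne hz₂l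
  set r₁ : ℝ := min (s - dist z₁ z) |((z₁ - z) * conj (innerNormal k')).re| / 2 with hr₁def
  set r₂ : ℝ := min (s - dist z₂ z) |((z₂ - z) * conj (innerNormal k)).re| / 2 with hr₂def
  have hr₁d : r₁ ≤ (s - dist z₁ z) / 2 := by
    have := min_le_left (s - dist z₁ z) |((z₁ - z) * conj (innerNormal k')).re|; rw [hr₁def]; linarith
  have hr₂d : r₂ ≤ (s - dist z₂ z) / 2 := by
    have := min_le_left (s - dist z₂ z) |((z₂ - z) * conj (innerNormal k)).re|; rw [hr₂def]; linarith
  have hroot₁ : D.pt 0 ∉ closedBall z₁ r₁ := fun h => hrootC (by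
    rw [mem_closedBall] at h ⊢; have := dist_triangle (D.pt 0) z₁ z; linarith [dist_nonneg (x := z₁) (y := z)])
  have hroot₂ : D.pt 0 ∉ closedBall z₂ r₂ := fun h => hrootC (by
    rw [mem_closedBall] at h ⊢; have := dist_triangle (D.pt 0) z₂ z; linarith [dist_nonneg (x := z₂) (y := z)])
  ---------------------------------------------------------------- eventual facts
  have E1 := hΘ2 z₁ k r₁ hr₁ hex₁ hroot₁
  have E2 := hΘ2 z₂ k' r₂ hr₂ hex₂ hroot₂
  have E3 := hns.eventually (eventually_exists_dart_near hAF hPR hset₁ hex₁ hroot₁ (ε := r₁ / 4) (by linarith)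
    (by linarith))
  have E4 := hns.eventually (eventually_exists_dart_near hAF hPR hset₂ hex₂ hroot₂ (ε := r₂ / 4) (by linarith)
    (by linarith))
  have E5 := hns.eventually (flat_dart_direction hAF hPR (show r₁ / 2 < r₁ by linarith) hex₁ hroot₁)
  have E6 := hns.eventually (flat_dart_direction hAF hPR (show r₂ / 2 < r₂ by linarith) hex₂ hroot₂)
  have E7 := hns.eventually (boundary_norms hAF hPR)
  have E8 := hns.eventually hAF.2.2.1
  have E8' := hns.eventually hPR.2.2.1
  have E9 : ∀ᶠ n in atTop, ((ns n : ℝ) : ℂ) * hexMidpoint (a (ns n)) ∉ ball z s := by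
    have hopen : IsOpen (closedBall z s)ᶜ := isClosed_closedBall.isOpen_compl
    filter_upwards [hns.eventually (hPR.2.2.2 (hopen.mem_nhds hrootC))] with n hn h
    exact hn (ball_subset_closedBall h)
  have E10 := hns.eventually hexC
  have E11 := hns.eventually (corner_pinning D ρ Λ m b hAF z k k' s hs hne hne' hsetC (s / 40) (by linarith))
  have E12 : ∀ᶠ n in atTop, ns n < min (min r₁ r₂) s / 40 :=
    hns.eventually (nhdsWithin_le_nhds (eventually_lt_nhds (by
      have : 0 < min (min r₁ r₂) s := lt_min (lt_min hr₁ hr₂) hs; linarith)))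
  have E13 := hns.eventually (self_mem_nhdsWithin : Ioi (0 : ℝ) ∈ 𝓝[>] (0 : ℝ))
  ---------------------------------------------------------------- the corner relation, eventually
  have hev : ∀ᶠ n in atTop, Θ n z₂ = cT * Θ n z₁ := by
    filter_upwards [E1, E2, E3, E4, E5, E6, E7, E8, E8', E9, E10, E11, E12, E13]
      with n h1 h2 h3 h4 h5 h6 h7 h8 h8' h9 h10 h11 h12 h13
    have hδ0 : (0 : ℝ) < ns n := h13
    set δ : ℝ := ns n with hδ
    have hδr₁ : δ < r₁ / 40 := by
      have := min_le_left (min r₁ r₂) s; have := min_le_left r₁ r₂; linarith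
    have hδr₂ : δ < r₂ / 40 := by
      have := min_le_left (min r₁ r₂) s; have := min_le_right r₁ r₂; linarith
    have hδs : δ < s / 40 := by have := min_le_right (min r₁ r₂) s; linarith
    obtain ⟨hsc, hbmem, -, hcen, -⟩ := h8
    obtain ⟨ha, -, -⟩ := h8'
    obtain ⟨hnorm, -⟩ := h7
    -- the two darts
    obtain ⟨v₁, t₁, hv₁, ht₁, hvt₁, hb₁⟩ := h3
    obtain ⟨v₂, t₂, hv₂, ht₂, hvt₂, hb₂⟩ := h4
    have hdir₁ := h5 v₁ t₁ hv₁ ht₁ hvt₁ (ball_subset_ball (by linarith) hb₁)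
    have hdir₂ := h6 v₂ t₂ hv₂ ht₂ hvt₂ (ball_subset_ball (by linarith) hb₂)
    have P1 := h1 v₁ t₁ hv₁ ht₁ hvt₁ (ball_subset_ball (by linarith) hb₁)
    have P2 := h2 v₂ t₂ hv₂ ht₂ hvt₂ (ball_subset_ball (by linarith) hb₂)
    -- the root dart
    obtain ⟨hae, u, w, hauw, hw, hu⟩ := ha
    have huw : hexGraph.Adj u w := by rw [hauw] at hae; exact (SimpleGraph.mem_edgeSet _).1 hae
    -- lattice units
    set x : ℂ := (δ : ℂ)⁻¹ * z with hx
    obtain ⟨nk, nk', hform⟩ := h10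
    have hpinx : (∀ v : HexVertex, hexCenter v ∈ ball x (s / δ) → (v ∈ Λ δ ↔ (nk ≤ zigzagForm k v ∧ nk' ≤ zigzagForm k' v))) ∨
        (∀ v : HexVertex, hexCenter v ∈ ball x (s / δ) → (v ∈ Λ δ ↔ (nk ≤ zigzagForm k v ∨ nk' ≤ zigzagForm k' v))) :=
      hform.imp (fun h v hv => h v ((smul_mem_ball_iff hδ0 _ z s).2 hv))
        (fun h v hv => h v ((smul_mem_ball_iff hδ0 _ z s).2 hv))
    -- pins
    have hA : |δ * (Real.sqrt 3 / 2) * nk - (z * conj (innerNormal k)).re| ≤ s / 40 ∧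
        |δ * (Real.sqrt 3 / 2) * nk' - (z * conj (innerNormal k')).re| ≤ s / 40 := by
      obtain ⟨hpA, hpO⟩ := h11 nk nk'
      rcases hform with hf | hf
      · exact ⟨(hpA hf).2.1, (hpA hf).2.2⟩
      · exact ⟨(hpO hf).2.1, (hpO hf).2.2⟩
    -- the corner face
    obtain ⟨v₀, hv₀, hv₀'⟩ := corner_forms_surjective k k' hne hne' nk nk'
    have hapex : ∃ v₀ : HexVertex, hexCenter v₀ ∈ ball x (s / δ - 7) ∧ zigzagForm k v₀ = nk ∧ zigzagForm k' v₀ = nk' := by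
      refine ⟨v₀, ?_, hv₀, hv₀'⟩
      have hl₁ := abs_form_level_sub_lt hδ0 k v₀
      have hl₂ := abs_form_level_sub_lt hδ0 k' v₀
      rw [hv₀] at hl₁; rw [hv₀'] at hl₂
      have e1 : |(((δ : ℂ) * hexCenter v₀ - z) * conj (innerNormal k)).re| ≤ s / 40 + δ := by
        rw [signedLevel_smul_sub]
        have := (abs_lt.1 hl₁); have := abs_le.1 hA.1
        rw [abs_le]; constructor <;> linarith
      have e2 : |(((δ : ℂ) * hexCenter v₀ - z) * conj (innerNormal k')).re| ≤ s / 40 + δ := by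
        rw [signedLevel_smul_sub]
        have := (abs_lt.1 hl₂); have := abs_le.1 hA.2
        rw [abs_le]; constructor <;> linarith
      have hn := norm_le_of_levels hne hne' ((δ : ℂ) * hexCenter v₀ - z)
      have hball : (δ : ℂ) * hexCenter v₀ ∈ ball z (s - 7 * δ) := by
        rw [mem_ball, dist_eq_norm]; linarith
      have := (smul_mem_ball_iff hδ0 _ z (s - 7 * δ)).1 hball
      rwa [show (s - 7 * δ) / δ = s / δ - 7 by field_simp] at this
    have hrootx : hexMidpoint s(u, w) ∉ ball x (s / δ) := fun h => by
      rw [hauw] at h9; exact h9 ((smul_mem_ball_iff hδ0 _ z s).2 h)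
    -- directions in the form of `sidePhase_corner`
    have hdir₁' : hexCenter t₁ - hexCenter v₁ = -((1 / Real.sqrt 3 : ℝ) : ℂ) * innerNormal k := by
      rw [hdir₁, one_div]
    have hdir₂' : hexCenter t₂ - hexCenter v₂ = -((1 / Real.sqrt 3 : ℝ) : ℂ) * innerNormal k' := by
      rw [hdir₂, one_div]
    -- midpoints in `ball x (s/δ - 4)`
    have hmid : ∀ {v t : HexVertex} {zc : ℂ} {r : ℝ}, hexGraph.Adj v t → (δ : ℂ) * hexCenter v ∈ ball zc (r / 4) →
        r ≤ (s - dist zc z) / 2 → δ < r / 40 → hexMidpoint s(v, t) ∈ ball x (s / δ - 4) := by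
      intro v t zc r hvt hvb hr hδr
      have hdm := ConjugateClassNegligibleSynthesis.dist_mid_center_le hδ0.le hvt
      have h1 : (δ : ℂ) * hexMidpoint s(v, t) ∈ ball z (s - 4 * δ) := by
        rw [mem_ball] at hvb ⊢
        have := dist_triangle ((δ : ℂ) * hexMidpoint s(v, t)) ((δ : ℂ) * hexCenter v) zc
        have := dist_triangle ((δ : ℂ) * hexMidpoint s(v, t)) zc z
        nlinarith [dist_nonneg (x := zc) (y := z)]
      have := (smul_mem_ball_iff hδ0 _ z (s - 4 * δ)).1 h1
      rwa [show (s - 4 * δ) / δ = s / δ - 4 by field_simp] at this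
    have heb₁ := hmid hvt₁ hb₁ hr₁d hδr₁
    have heb₂ := hmid hvt₂ hb₂ hr₂d hδr₂
    -- the corner relation
    have SC := sidePhase_corner (Λ δ) hsc u w huw hu hw k k' nk nk' x (s / δ) hne hne' hpinx hapex hrootx
      v₁ t₁ v₂ t₂ hv₁ ht₁ hvt₁ hv₂ ht₂ hvt₂ hdir₁' hdir₂' heb₁ heb₂
    rw [← hauw] at SC
    -- norms and cancellation
    have he₁ : s(v₁, t₁) ∈ hexDomainBoundary (Λ δ) := ⟨(SimpleGraph.mem_edgeSet _).2 hvt₁, t₁, v₁, Sym2.eq_swap, hv₁, ht₁⟩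
    have he₂ : s(v₂, t₂) ∈ hexDomainBoundary (Λ δ) := ⟨(SimpleGraph.mem_edgeSet _).2 hvt₂, t₂, v₂, Sym2.eq_swap, hv₂, ht₂⟩
    have hZ₁ : ((‖hexParafermionicObservable (Λ δ) (a δ) hexCriticalFugacity 0 s(v₁, t₁)‖ : ℝ) : ℂ) ≠ 0 :=
      Complex.ofReal_ne_zero.2 (hnorm _ he₁).2.ne'
    have hZ₂ : ((‖hexParafermionicObservable (Λ δ) (a δ) hexCriticalFugacity 0 s(v₂, t₂)‖ : ℝ) : ℂ) ≠ 0 :=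
      Complex.ofReal_ne_zero.2 (hnorm _ he₂).2.ne'
    have hFb : hexParafermionicObservable (Λ δ) (a δ) hexCriticalFugacity (5 / 8) (b δ) ≠ 0 := by
      intro h0
      have h := (hnorm _ hbmem).1
      rw [h0, norm_zero] at h
      exact (hnorm _ hbmem).2.ne' h.symm
    have key : (Θ n z₂ - cT * Θ n z₁) *
        (((‖hexParafermionicObservable (Λ δ) (a δ) hexCriticalFugacity 0 s(v₁, t₁)‖ : ℝ) : ℂ) *
          ((‖hexParafermionicObservable (Λ δ) (a δ) hexCriticalFugacity 0 s(v₂, t₂)‖ : ℝ) : ℂ) *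
          hexParafermionicObservable (Λ δ) (a δ) hexCriticalFugacity (5 / 8) (b δ)) = 0 := by
      linear_combination (-((‖hexParafermionicObservable (Λ δ) (a δ) hexCriticalFugacity 0 s(v₁, t₁)‖ : ℝ) : ℂ)) * P2 +
        cT * ((‖hexParafermionicObservable (Λ δ) (a δ) hexCriticalFugacity 0 s(v₂, t₂)‖ : ℝ) : ℂ) * P1 +
        ((‖hexParafermionicObservable (Λ δ) (a δ) hexCriticalFugacity 0 (b δ)‖ : ℝ) : ℂ) * SC
    rcases mul_eq_zero.1 key with h0 | h0
    · exact sub_eq_zero.1 h0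
    · exact absurd h0 (mul_ne_zero (mul_ne_zero hZ₁ hZ₂) hFb)
  ---------------------------------------------------------------- the limit along `U`
  have hlim : Tendsto (fun n => cT * Θ n z₁) U (𝓝 (cT * κ z₁)) := (hκT z₁).const_mul cT
  exact tendsto_nhds_unique ((hκT z₂).congr' (hev.filter_mono hUle)) hlim

end Summit.CriticalPhenomena.SAWScalingLimit.Theorems.PolygonParitySqueeze.PolygonLocal

end
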